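import Mathlib.NumberTheory.NumberField.Basic
import Mathlib.NumberTheory.Height.NumberField
import Mathlib.AlgebraicGeometry.EllipticCurve.Affine.Point
import Literature.NumberTheory.EllipticCurves.GlobalMinimalModel
import Literature.NumberTheory.EllipticCurves.Heights
import Literature.NumberTheory.EllipticCurves.HeightsProofs
import Literature.NumberTheory.DiophantineGeometry.MinimalDiscriminant
import Literature.NumberTheory.DiophantineGeometry.CanonicalHeight
import HarnessLib

-- provenance: harness21/H21/H21/Prelude/DiophValNum/EllArithGlue.lean @ 2415787 (interim HEAD d8f2665); M5 mechanical rewrite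
/-!
# Glue between `DiophValNum` (G22) and `TranscendEllArithS` (G06)

Trunk: `DiophValNum` (G22), item `EllArithGlue`.

The trunk `DiophValNum` develops the *local* notions `WeierstrassCurve.IsMinimalAt v W`,
`WeierstrassCurve.minimalDiscriminantNorm A W` (files `LocalReduction`, `MinimalDiscriminant`) and
the *abstract* Néron–Tate interface `Literature.NumberTheory.DiophantineGeometry.IsCanonicalHeightFor`, `Literature.NumberTheory.DiophantineGeometry.canonicalHeightOf`,
`Literature.NumberTheory.DiophantineGeometry.neronTatePairing` (file `CanonicalHeight`). The trunk `TranscendEllArithS` (G06) develops the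
*global / elliptic* versions `WeierstrassCurve.IsGloballyMinimal`,
`WeierstrassCurve.minimalDiscriminantInt` (file `GlobalMinimalModel`) and
`WeierstrassCurve.Affine.Point.naiveHeight / canonicalHeight / heightPairing` (file `Heights`).
This file records that the two sides agree:

* `WeierstrassCurve.IsGloballyMinimal.isMinimalAt`,
  `WeierstrassCurve.isGloballyMinimal_iff_forall_isMinimalAt`: global minimality is minimality at
  every finite place (both sides use the completion convention `O_v = v.adicCompletionIntegers K`,
  so `→` is definitional; `←` needs "integral at every `v` ⇒ integral over `𝓞 K`");
* `WeierstrassCurve.minimalDiscriminantNorm_int_eq_natAbs_minimalDiscriminantInt`: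
  `N (𝔇_min) = |Δ_min|` over `ℚ`;
* `WeierstrassCurve.Affine.Point.isCanonicalHeightFor_canonicalHeight`: for an elliptic curve over a
  number field, G06's `canonicalHeight` is a canonical height for G06's `naiveHeight` in the sense of
  `Literature.NumberTheory.DiophantineGeometry.IsCanonicalHeightFor` (Tate; Silverman AEC VIII.9.1/9.3),
  proved (`isCanonicalHeightFor_canonicalHeight_holds`) from the dischargers of G06's
  `parallelogram_law` and `exists_abs_canonicalHeight_sub_naiveHeight_le` (file `HeightsProofs`, the
  one proof import of this file);
* `WeierstrassCurve.Affine.Point.canonicalHeight_eq_canonicalHeightOf`,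
  `WeierstrassCurve.Affine.Point.heightPairing_eq_neronTatePairing`: the G06 definitions are
  literally the G22 constructions applied to `naiveHeight` / `canonicalHeight` (`rfl`).

## Design notes

* No new definitions. All declarations are deliberate dot-notation extensions of Mathlib's
  namespaces `WeierstrassCurve` and `WeierstrassCurve.Affine.Point`, matching the G06 files they
  glue to.
* As in G06 (`Heights`, group rule of that trunk) we work in `noncomputable section` with
  `open scoped Classical` and **no** `[DecidableEq K]` variable, so that Mathlib's
  `AddCommGroup W.toAffine.Point` instance (which needs `DecidableEq K`) is elaborated against the
  same (classical) instance on both sides of each glue equation; otherwise the `rfl` proofs would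
  compare `2 ^ n • P` for two different decidability instances.
* `isCanonicalHeightFor_canonicalHeight` is stated over a number field (with Mathlib's instance
  `NumberField.instAdmissibleAbsValues`), because the two G06 inputs are number-field theorems;
  the two `rfl` lemmas hold over any `[Height.AdmissibleAbsValues K]`. Its hypothesis
  `[W.IsElliptic]` (Silverman VIII.9.1/9.3: "let `E/K` be an elliptic curve") is quantified
  **inside** the body, as in G06's `Heights`: a `Prop`-valued `def` whose body does not use a
  section instance silently drops it, and without it the statement is false (for the cuspidal cubic
  `y² = x³` over `ℚ` one has `E_ns(ℚ) ≅ ℚ⁺`, `x(2P) = x(P)/4`, so `ĥ = 0` while `h` is unbounded).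
* `minimalDiscriminantNorm_int_eq_natAbs_minimalDiscriminantInt` carries `[W.IsElliptic]`: for a
  singular `W` the left-hand side is the documented junk value `1` of `minimalDiscriminantNorm`
  while the right-hand side is `0`.
* Mathlib search: Mathlib has `WeierstrassCurve.IsMinimal`, `WeierstrassCurve.IsIntegral`
  (`Mathlib/AlgebraicGeometry/EllipticCurve/Reduction.lean`), `Height.logHeight₁`,
  `Height.AdmissibleAbsValues`; it has no global minimal model, minimal discriminant, canonical
  height or height pairing (grep `IsGloballyMinimal`, `minimalDiscriminant`, `canonicalHeight`,
  `NeronTate`: nothing), so there is nothing to reuse beyond what the four imported H21 files use.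

## References

* J. H. Silverman, *The Arithmetic of Elliptic Curves*, GTM 106, 2nd ed. 2009, VII.1, VIII.8
  (minimal models and minimal discriminant), VIII.9 (canonical height, Prop. 9.1, Thm. 9.3).
* J. Tate, letter to Serre (1962); M. Hindry, J. Silverman, *Diophantine Geometry*, Thm. B.5.1.
-/

noncomputable section

open scoped Classical
open NumberField IsDedekindDomain

/-! ### Global minimality vs. minimality at every place

Dot-notation extensions of Mathlib's `WeierstrassCurve` namespace. -/

namespace WeierstrassCurve

section NumberField

variable {K : Type*} [Field K] [NumberField K]

/-- A globally minimal Weierstrass equation (`WeierstrassCurve.IsGloballyMinimal`, G06 file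
`TranscendEllArithS.GlobalMinimalModel`) is minimal at every finite place `v` in the sense of
`WeierstrassCurve.IsMinimalAt` (G22 file `DiophValNum.LocalReduction`). Both sides say that
`W.baseChange K_v` is `WeierstrassCurve.IsMinimal` over `O_v = v.adicCompletionIntegers K`, so this
is the field `IsGloballyMinimal.isMinimal`. Silverman, AEC VIII.8 (definition of a global minimal
Weierstrass equation). [folklore] -/
theorem IsGloballyMinimal.isMinimalAt (W : WeierstrassCurve K) [hW : W.IsGloballyMinimal]
    (v : HeightOneSpectrum (𝓞 K)) : W.IsMinimalAt v :=
  hW.isMinimal v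

/-- Global minimality (`WeierstrassCurve.IsGloballyMinimal`, G06) is equivalent to minimality at
every finite place (`WeierstrassCurve.IsMinimalAt`, G22). The direction `→` is the field
`IsGloballyMinimal.isMinimal`; the direction `←` additionally needs that a Weierstrass equation which
is `v`-integral at every finite place `v` of the number field `K` has coefficients in `𝓞 K`
(integrality over the Dedekind domain `𝓞 K` is a local property: `𝓞 K = ⋂_v (K ∩ O_v)`).
Silverman, AEC VIII.8 (definition preceding Prop. 8.2). PROVED:
`isGloballyMinimal_iff_forall_isMinimalAt_holds` (`EllArithGlueMinimalProofs.lean`).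
[cite: SilvermanAEC2009, VIII §8, definition of a global minimal Weierstrass equation (before Prop. 8.2)] -/
def isGloballyMinimal_iff_forall_isMinimalAt : Prop :=
  ∀ (W : WeierstrassCurve K),
    W.IsGloballyMinimal ↔ ∀ v : HeightOneSpectrum (𝓞 K), W.IsMinimalAt v

/- interim partial proof (harness21 @ d8f2665), preserved for route work:
:= by
  refine ⟨fun hW v => hW.isMinimal v, fun h => ⟨?_, h⟩⟩
  -- integrality over `𝓞 K` from integrality at every finite place
  sorry
-/

end NumberField

section Rat

/-- Over `ℚ`, the norm of the minimal discriminant ideal computed over `ℤ`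
(`WeierstrassCurve.minimalDiscriminantNorm ℤ W`, G22 file `DiophValNum.MinimalDiscriminant`) is the
absolute value of the minimal discriminant `WeierstrassCurve.minimalDiscriminantInt W` of G06 (file
`TranscendEllArithS.GlobalMinimalModel`, the discriminant of the integral model over `ℤ` of the
globally minimal equation `W`). Proof route: `W = (integralModelInt W).baseChange ℚ`
(`map_integralModelInt`), then `minimalDiscriminantNorm_eq_natAbs`, transporting minimality at the
places of `𝓞 ℚ` to the places of `ℤ` along `Rat.ringOfIntegersEquiv`
(cf. `minimalDiscriminantNorm_ringOfIntegers_rat`). The hypothesis `[W.IsElliptic]` is needed: for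
`Δ = 0` the left-hand side is the junk value `1` and the right-hand side is `0`.
Silverman, AEC VIII.8 (minimal discriminant over `ℚ`, Cor. 8.3). PROVED:
`minimalDiscriminantNorm_int_eq_natAbs_minimalDiscriminantInt_holds` (`EllArithGlueProofs.lean`).
[cite: SilvermanAEC2009, VIII §8, definition of the minimal discriminant 𝒟_E/K and Cor. 8.3] -/
def minimalDiscriminantNorm_int_eq_natAbs_minimalDiscriminantInt : Prop :=
  ∀ (W : WeierstrassCurve ℚ) [W.IsElliptic] [W.IsGloballyMinimal],
    W.minimalDiscriminantNorm ℤ = (minimalDiscriminantInt W).natAbs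

end Rat

end WeierstrassCurve

/-! ### Canonical heights

Dot-notation extensions of Mathlib's `WeierstrassCurve.Affine.Point` namespace, as in G06's
`TranscendEllArithS.Heights`. -/

namespace WeierstrassCurve.Affine.Point

section Defs

variable {K : Type*} [Field K] [Height.AdmissibleAbsValues K] {W : WeierstrassCurve K}

/-- G06's Néron–Tate canonical height `WeierstrassCurve.Affine.Point.canonicalHeight`
(file `TranscendEllArithS.Heights`) *is* Tate's limit construction `Literature.NumberTheory.DiophantineGeometry.canonicalHeightOf`
(G22 file `DiophValNum.CanonicalHeight`) applied to G06's `naiveHeight`: both are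
`fun P ↦ limUnder atTop (fun n ↦ h (2 ^ n • P) / 4 ^ n)`. Silverman, AEC Prop. VIII.9.1;
Tate (1962). [cite: SilvermanAEC2009, VIII §9 Prop. 9.1 (Tate)] -/
theorem canonicalHeight_eq_canonicalHeightOf :
    (canonicalHeight : W.toAffine.Point → ℝ) = Literature.NumberTheory.DiophantineGeometry.canonicalHeightOf naiveHeight :=
  rfl

/-- G06's Néron–Tate height pairing `WeierstrassCurve.Affine.Point.heightPairing`
(file `TranscendEllArithS.Heights`) is the abstract pairing `Literature.NumberTheory.DiophantineGeometry.neronTatePairing`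
(G22 file `DiophValNum.CanonicalHeight`) of G06's `canonicalHeight`: both are
`(ĥ (P + Q) - ĥ P - ĥ Q) / 2`. Silverman, AEC Thm. VIII.9.3 (Clay/Wiles normalisation).
[cite: SilvermanAEC2009, VIII §9 Thm. 9.3 and the Definition of the canonical height pairing] -/
theorem heightPairing_eq_neronTatePairing (P Q : W.toAffine.Point) :
    heightPairing P Q = Literature.NumberTheory.DiophantineGeometry.neronTatePairing canonicalHeight P Q :=
  rfl

end Defs

section NumberField

variable {K : Type*} [Field K] [NumberField K] {W : WeierstrassCurve K}

/-- Over a number field, for an elliptic curve `E/K` (`[W.IsElliptic]`, quantified in the body —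
see the design notes), G06's `WeierstrassCurve.Affine.Point.canonicalHeight` is a canonical
height for G06's `WeierstrassCurve.Affine.Point.naiveHeight` in the sense of the G22 interface
`Literature.NumberTheory.DiophantineGeometry.IsCanonicalHeightFor` (file `DiophValNum.CanonicalHeight`): it satisfies the parallelogram law
(G06 `WeierstrassCurve.Affine.Point.parallelogram_law`) and differs from the naive height by a
bounded amount (G06 `WeierstrassCurve.Affine.Point.exists_abs_canonicalHeight_sub_naiveHeight_le`).
Consequently all of the abstract API (`IsCanonicalHeightFor.unique`, `.map_nsmul`,
`.finite_setOf_le`, `Literature.NumberTheory.DiophantineGeometry.neronTatePairing_self`, …) applies to `E(K)`.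
Tate (1962); Silverman, AEC Prop. VIII.9.1 and Thm. VIII.9.3 ("Let `E/K` be an elliptic curve").
PROVED: `isCanonicalHeightFor_canonicalHeight_holds` (below).
[cite: SilvermanAEC2009, VIII §9 Prop. 9.1 (Tate) and Thm. 9.3 (Néron, Tate)] -/
def isCanonicalHeightFor_canonicalHeight : Prop :=
  ∀ [W.IsElliptic],
    Literature.NumberTheory.DiophantineGeometry.IsCanonicalHeightFor (naiveHeight (W := W)) canonicalHeight

/-- **Discharge of the named fact `isCanonicalHeightFor_canonicalHeight`** (Tate; Silverman, AEC
Prop. VIII.9.1 and Thm. VIII.9.3 (a), (e), for an elliptic curve over a number field): the two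
fields of `IsCanonicalHeightFor` are exactly the G06 facts `parallelogram_law` (Thm. 9.3 (a)) and
`exists_abs_canonicalHeight_sub_naiveHeight_le` (Thm. 9.3 (e) with `f = x`), both discharged in
`Literature.NumberTheory.EllipticCurves.HeightsProofs`. This is the file's original (pre-M5) interim
proof `⟨parallelogram_law, exists_abs_canonicalHeight_sub_naiveHeight_le⟩`, restored through the
dischargers. [cite: SilvermanAEC2009, VIII §9 Prop. 9.1 (Tate) and Thm. 9.3 (a), (e)] -/
theorem isCanonicalHeightFor_canonicalHeight_holds : isCanonicalHeightFor_canonicalHeight (W := W) :=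
  ⟨parallelogram_law_holds, exists_abs_canonicalHeight_sub_naiveHeight_le_holds⟩

end NumberField

end WeierstrassCurve.Affine.Point

end
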